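import Summits.SmoothPoincare4.SmoothPoincare4.Theorems.ConvexBisectionAcyclicBisectionExistsKasBaseBoundary
import Literature.Topology.FourManifolds.LefschetzBaseBetti
import Literature.Topology.FourManifolds.AttachingMapBoundaryTube
import Literature.AlgebraicTopology.SingularHomology.ClopenCountFunctional
import HarnessLib

/-!
# Circles in the boundary: `∂B ∖ ⋃ Kᵢ` stays connected, and `∂ Base g` is connected
# (T3 clause (v), CONNECTED — part 1)
(helper for stub `stub_T3_dualPresentation` = T3, extras ▸ clause (v) `ConnectedSpace b₁.carrier`
for the prefix piece `X₁`; line `modp-braid-orbits` r12, crux `ConvexBisection.AcyclicBisectionExists`,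
item stmt-SmoothPoincare4-10508; wave 5 / worker X6, lead c5; Y7-REPORT §2 row (v).  Part 2,
`…BoundaryConnected.lean`, assembles the seam `∂X` of a multi-attachment from these inputs.)

* §1 `isPreconnected_compl_of_local` — point-set engine: in a preconnected space, a set `C` with
  dense complement, each of whose points has a neighbourhood `U` with `U ∖ C` preconnected, has
  preconnected complement (the closures of the two halves of a separation of `Cᶜ` cover the space
  and meet; a meeting point on `C` is excluded by the local hypothesis, one off `C` by openness);
  `isPreconnected_ball_diff_zero` — the punctured disc `D² ∖ 0` is preconnected;
* §2 `isPreconnected_compl_iUnion_core` — removing the cores of circle tubes (`CircleTube`: tubular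
  neighbourhoods `S¹ × D² ⇀ Y` of circles in a 3-manifold) with pairwise disjoint targets keeps a
  preconnected 3-manifold preconnected: the target of a tube minus the cores is the image of the
  punctured unit tube `S¹ × (D² ∖ 0)` (`target_diff_iUnion_core`), and core points are limits of
  points off the cores (`dense_compl_iUnion_core`);
* §3 `isPreconnected_boundary_off_cores` — for attaching maps `h̄ᵢ : T → B` of 2-handles with
  disjoint ranges on a 4-manifold `B` with preconnected boundary, `∂B ∖ ⋃ Kᵢ` is preconnected and
  nonempty (§2 for the boundary tubes `HandleAttachingMap.boundaryTube`, whose cores are the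
  attaching circles `Kᵢ`);
* §4 `isConnected_boundary_base` — `∂ Base g` is connected: `H₂ = H₃ = 0` for `Base g` (Milnor
  cover, `isZero_singularHomology_base_of_two_le`) give `H³(Base g; ℤ) = 0`, hence
  `H₁(Base g, ∂; ℤ) = 0` by integral Lefschetz duality
  (`isZero_relHomology_int_of_subsingleton_cohomology`), hence `H₀(∂ Base g) → H₀(Base g)` is
  injective (pair sequence); a clopen proper subset of `∂ Base g` would give two point classes
  separated by its counting functional (`clopenCountH`) yet identified in the path-connected base.
  Registered sub-goal: `helper_isConnected_boundary_base`.

Everything is proved; no definitions, no named facts, no `sorry`.  References: A. A. Kosinski,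
*Differential Manifolds* (1993), VI §6 [Kosinski1993]; R. E. Gompf, A. I. Stipsicz, *4-Manifolds and
Kirby Calculus* (1999), §8.2 (`∂(F × D²) = #^{2g} S¹ × S²`) [GompfStipsicz1999]; A. Hatcher,
*Algebraic Topology* (2002), Prop. 2.7, Thm. 3.43 [HatcherAT2002].
-/

noncomputable section

-- the prescribed namespace `Summit.<P>.<Sub>.…` duplicates `SmoothPoincare4` (P = Sub)
set_option linter.dupNamespace false

open scoped Manifold ContDiff Topology
open Set Function Filter Metric CategoryTheory CategoryTheory.Limits
open Literature.Topology.FourManifolds Literature.Topology.FourManifolds.LefschetzBase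
  Literature.Topology.FourManifolds.HandleAttachingMap Literature.AlgebraicTopology.SingularHomology

namespace Summit.SmoothPoincare4.SmoothPoincare4.Theorems.AcyclicBisectionExists.ModpBraidOrbits

namespace BoundaryConnected


/-! ## §1 Removing a set with locally preconnected complement -/

/-- **A set with dense complement, each of whose points has a neighbourhood `U` with `U ∖ C`
preconnected, has preconnected complement in a preconnected space.** [folklore] -/
theorem isPreconnected_compl_of_local {α : Type*} [TopologicalSpace α] [PreconnectedSpace α]
    {C : Set α} (hd : Dense Cᶜ) (hloc : ∀ x ∈ C, ∃ U ∈ 𝓝 x, IsPreconnected (U \ C)) :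
    IsPreconnected Cᶜ := by
  intro u v hu hv huv hCu hCv
  by_contra hne
  rw [Set.not_nonempty_iff_eq_empty] at hne
  have hcov : (univ : Set α) ⊆ closure (Cᶜ ∩ u) ∪ closure (Cᶜ ∩ v) := by
    rw [← closure_union, ← inter_union_distrib_left, inter_eq_left.2 huv, hd.closure_eq]
  obtain ⟨x, -, hxu, hxv⟩ := isPreconnected_closed_iff.1 isPreconnected_univ _ _ isClosed_closure
    isClosed_closure hcov ⟨hCu.some, mem_univ _, subset_closure hCu.some_mem⟩
    ⟨hCv.some, mem_univ _, subset_closure hCv.some_mem⟩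
  by_cases hxC : x ∈ C
  · obtain ⟨U, hU, hUC⟩ := hloc x hxC
    obtain ⟨y, ⟨-, hyC⟩, hyu, hyv⟩ := hUC u v hu hv (sdiff_subset_iff.2 (fun z hz => by
        by_cases hzC : z ∈ C
        · exact Or.inl hzC
        · exact Or.inr (huv hzC)))
      (by obtain ⟨y, hyU, hyC, hyu⟩ := mem_closure_iff_nhds.1 hxu U hU
          exact ⟨y, ⟨hyU, hyC⟩, hyu⟩)
      (by obtain ⟨y, hyU, hyC, hyv⟩ := mem_closure_iff_nhds.1 hxv U hU
          exact ⟨y, ⟨hyU, hyC⟩, hyv⟩)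
    have : y ∈ Cᶜ ∩ (u ∩ v) := ⟨hyC, hyu, hyv⟩
    rw [hne] at this
    exact this
  · rcases huv hxC with hx | hx
    · obtain ⟨y, hyu, hyC, hyv⟩ := mem_closure_iff_nhds.1 hxv u (hu.mem_nhds hx)
      have : y ∈ Cᶜ ∩ (u ∩ v) := ⟨hyC, hyu, hyv⟩
      rw [hne] at this
      exact this
    · obtain ⟨y, hyv', hyC, hyu⟩ := mem_closure_iff_nhds.1 hxu v (hv.mem_nhds hx)
      have : y ∈ Cᶜ ∩ (u ∩ v) := ⟨hyC, hyu, hyv'⟩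
      rw [hne] at this
      exact this

/-- **The punctured unit disc of the plane is preconnected** (image of `(0, 1) × S¹`). [folklore] -/
theorem isPreconnected_ball_diff_zero :
    IsPreconnected (ball (0 : EuclideanSpace ℝ (Fin 2)) 1 \ {0}) := by
  have hS : IsConnected (sphere (0 : EuclideanSpace ℝ (Fin 2)) 1) := by
    refine isConnected_sphere ?_ _ zero_le_one
    rw [← Module.finrank_eq_rank, finrank_euclideanSpace_fin]; norm_num
  have himage : (fun p : ℝ × EuclideanSpace ℝ (Fin 2) => p.1 • p.2) ''
      (Ioo (0 : ℝ) 1 ×ˢ sphere (0 : EuclideanSpace ℝ (Fin 2)) 1) =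
      ball (0 : EuclideanSpace ℝ (Fin 2)) 1 \ {0} := by
    ext v
    simp only [mem_image, mem_prod, mem_Ioo, mem_sphere_zero_iff_norm, Set.mem_sdiff, mem_ball,
      dist_zero_right, mem_singleton_iff, Prod.exists]
    constructor
    · rintro ⟨r, θ, ⟨⟨hr0, hr1⟩, hθ⟩, rfl⟩
      refine ⟨by rw [norm_smul, Real.norm_eq_abs, abs_of_pos hr0, hθ, mul_one]; exact hr1, ?_⟩
      rw [smul_eq_zero, not_or]
      exact ⟨hr0.ne', fun h => by rw [h, norm_zero] at hθ; exact zero_ne_one hθ⟩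
    · rintro ⟨hv1, hv0⟩
      have hn : 0 < ‖v‖ := norm_pos_iff.2 hv0
      refine ⟨‖v‖, ‖v‖⁻¹ • v, ⟨⟨hn, hv1⟩, ?_⟩, ?_⟩
      · rw [norm_smul, norm_inv, norm_norm, inv_mul_cancel₀ hn.ne']
      · rw [smul_smul, mul_inv_cancel₀ hn.ne', one_smul]
  rw [← himage]
  exact ((isPreconnected_Ioo).prod hS.isPreconnected).image _
    ((continuous_fst.smul continuous_snd).continuousOn)

/-! ## §2 Removing the cores of circle tubes with disjoint targets -/

section Tubes

variable {Y : Type*} [TopologicalSpace Y] [ChartedSpace (EuclideanSpace ℝ (Fin 3)) Y] {ι : Type*}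
  (Φ : ι → CircleTube Y)
  (hdisj : Pairwise fun i j => Disjoint (Φ i).toHomeo.target (Φ j).toHomeo.target)

include hdisj in
/-- For a point `q` of the source of the `i`-th tube, `Φᵢ q` lies on one of the cores iff `q` is on
the zero section (disjoint targets; `Φᵢ` injective on its source). [folklore] -/
theorem apply_mem_iUnion_core_iff (i : ι) {q : (sphere (0 : EuclideanSpace ℝ (Fin 2)) 1) ×
    EuclideanSpace ℝ (Fin 2)} (hq : q ∈ (Φ i).toHomeo.source) :
    (Φ i).toHomeo q ∈ (⋃ j, range (Φ j).core) ↔ q.2 = 0 := by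
  constructor
  · intro hm
    obtain ⟨j, θ, hθ⟩ := mem_iUnion.1 hm
    have hji : j = i := by
      by_contra hji
      have h1 : (Φ i).toHomeo q ∈ (Φ j).toHomeo.target := hθ ▸ (Φ j).core_mem_target θ
      exact Set.disjoint_left.1 (hdisj hji) h1 ((Φ i).toHomeo.map_source hq)
    subst hji
    rw [CircleTube.core_apply] at hθ
    have := (Φ j).toHomeo.injOn ((Φ j).mem_source_zero θ) hq hθ
    rw [← this]
  · intro h0
    refine mem_iUnion.2 ⟨i, q.1, ?_⟩
    rw [CircleTube.core_apply]
    congr 1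
    exact Prod.ext rfl h0.symm

include hdisj in
/-- **The complement of the cores is dense**: the core point `Φᵢ (θ, 0)` is the limit of the points
`Φᵢ (θ, t e₀)`, `t ↓ 0`, which lie off the cores. [folklore] -/
theorem dense_compl_iUnion_core : Dense (⋃ j, range (Φ j).core)ᶜ := by
  intro x
  by_cases hx : x ∈ ⋃ j, range (Φ j).core
  · obtain ⟨i, θ, rfl⟩ := mem_iUnion.1 hx
    set e₀ : EuclideanSpace ℝ (Fin 2) := EuclideanSpace.single 0 1 with he₀
    have he₀n : ‖e₀‖ = 1 := by rw [he₀, PiLp.norm_single, norm_one]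
    set f : ℝ → Y := fun t => (Φ i).toHomeo (θ, t • e₀) with hf
    have hcont : ContinuousAt f 0 := by
      have h2 : Continuous fun t : ℝ => ((θ, t • e₀) : (sphere (0 : EuclideanSpace ℝ (Fin 2)) 1) ×
          EuclideanSpace ℝ (Fin 2)) := continuous_const.prodMk (continuous_id.smul continuous_const)
      have h1 : ContinuousAt (Φ i).toHomeo ((fun t : ℝ => ((θ, t • e₀) :
          (sphere (0 : EuclideanSpace ℝ (Fin 2)) 1) × EuclideanSpace ℝ (Fin 2))) 0) := by
        simp only [zero_smul]
        exact (Φ i).toHomeo.continuousAt ((Φ i).mem_source_zero θ)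
      exact ContinuousAt.comp (f := fun t : ℝ => ((θ, t • e₀) :
          (sphere (0 : EuclideanSpace ℝ (Fin 2)) 1) × EuclideanSpace ℝ (Fin 2))) h1 h2.continuousAt
    have hlim : Tendsto f (𝓝[>] 0) (𝓝 ((Φ i).core θ)) := by
      have : f 0 = (Φ i).core θ := by rw [hf]; simp
      rw [← this]
      exact hcont.tendsto.mono_left nhdsWithin_le_nhds
    refine mem_closure_of_tendsto hlim ?_
    filter_upwards [Ioo_mem_nhdsGT (one_pos (α := ℝ))] with t ht
    have hsrc : (θ, t • e₀) ∈ (Φ i).toHomeo.source := by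
      rw [(Φ i).mem_source_iff, norm_smul, he₀n, mul_one, Real.norm_eq_abs, abs_of_pos ht.1]
      exact ht.2
    show f t ∉ ⋃ j, range (Φ j).core
    rw [hf, apply_mem_iUnion_core_iff Φ hdisj i hsrc, smul_eq_zero, not_or]
    exact ⟨ht.1.ne', fun h => by rw [h, norm_zero] at he₀n; exact zero_ne_one he₀n⟩
  · exact subset_closure hx

include hdisj in
/-- **The target of a tube minus the cores is the image of the punctured unit tube
`S¹ × (D² ∖ 0)`.** [folklore] -/
theorem target_diff_iUnion_core (i : ι) :
    (Φ i).toHomeo.target \ (⋃ j, range (Φ j).core) =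
      (Φ i).toHomeo '' ((univ : Set (sphere (0 : EuclideanSpace ℝ (Fin 2)) 1)) ×ˢ
        (ball (0 : EuclideanSpace ℝ (Fin 2)) 1 \ {0})) := by
  ext y
  constructor
  · rintro ⟨hy, hyC⟩
    have hq : (Φ i).toHomeo.symm y ∈ (Φ i).toHomeo.source := (Φ i).toHomeo.map_target hy
    refine ⟨(Φ i).toHomeo.symm y, ⟨mem_univ _, ?_, ?_⟩, (Φ i).apply_symm_apply hy⟩
    · exact mem_ball_zero_iff.2 ((Φ i).mem_source_iff.1 (by rw [Prod.mk.eta]; exact hq))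
    · intro h0
      apply hyC
      rw [← (Φ i).apply_symm_apply hy, apply_mem_iUnion_core_iff Φ hdisj i hq]
      exact h0
  · rintro ⟨q, ⟨-, hq1, hq0⟩, rfl⟩
    have hq : q ∈ (Φ i).toHomeo.source := by
      rw [← Prod.mk.eta (p := q), (Φ i).mem_source_iff]; exact mem_ball_zero_iff.1 hq1
    exact ⟨(Φ i).toHomeo.map_source hq, fun h =>
      hq0 ((apply_mem_iUnion_core_iff Φ hdisj i hq).1 h)⟩

include hdisj in
/-- **Removing the cores of circle tubes with pairwise disjoint targets from a preconnected
3-manifold leaves a preconnected set** (codimension two: near a core point the complement is the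
image of the preconnected punctured tube, §1). [folklore] -/
theorem isPreconnected_compl_iUnion_core [PreconnectedSpace Y] :
    IsPreconnected (⋃ j, range (Φ j).core)ᶜ := by
  have hS : PreconnectedSpace (sphere (0 : EuclideanSpace ℝ (Fin 2)) 1) := by
    refine isPreconnected_iff_preconnectedSpace.1 (isConnected_sphere ?_ _ zero_le_one).isPreconnected
    rw [← Module.finrank_eq_rank, finrank_euclideanSpace_fin]; norm_num
  refine isPreconnected_compl_of_local (dense_compl_iUnion_core Φ hdisj) fun x hx => ?_
  obtain ⟨i, θ, rfl⟩ := mem_iUnion.1 hx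
  refine ⟨(Φ i).toHomeo.target, (Φ i).toHomeo.open_target.mem_nhds ((Φ i).core_mem_target θ), ?_⟩
  rw [target_diff_iUnion_core Φ hdisj i]
  refine (isPreconnected_univ.prod isPreconnected_ball_diff_zero).image _
    ((Φ i).toHomeo.continuousOn.mono ?_)
  rw [(Φ i).source_eq]
  exact prod_mono le_rfl sdiff_subset

end Tubes

/-! ## §3 The boundary of the base off the attaching circles -/

section Base

variable {B : Type*} [TopologicalSpace B] [T2Space B] [ChartedSpace (EuclideanHalfSpace 4) B]
  [IsManifold (𝓡∂ 4) ∞ B] {ι : Type*} [Finite ι] (h : ι → HandleAttachingMap 3 2 B)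

/-- The boundary points of `B` off the attaching circles `Kᵢ = h̄ᵢ(S)` form the complement of the
cores of the boundary tubes of the `h̄ᵢ` (`coe_boundaryTube_core`, `range_attachingCircle`).
[cite: Kosinski1993, VI §6] -/
theorem boundary_off_cores_eq :
    {p : ↥((𝓡∂ 4).boundary B) | (p : B) ∈ coresComplement h} =
      (⋃ j, range (h j).boundaryTube.core)ᶜ := by
  ext p
  simp only [mem_setOf_eq, mem_coresComplement, mem_compl_iff, mem_iUnion, mem_range, not_exists]
  constructor
  · intro hp j θ he
    apply hp j
    rw [← he, coe_boundaryTube_core]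
    exact (h j).attachingCircle_mem_core θ
  · intro hp j hc
    rw [← (h j).range_attachingCircle] at hc
    obtain ⟨θ, hθ⟩ := hc
    exact hp j θ (Subtype.ext ((coe_boundaryTube_core (h j) θ).trans hθ))

/-- **`∂B ∖ ⋃ Kᵢ` is preconnected** for attaching maps of 2-handles with pairwise disjoint ranges on
a 4-manifold `B` with preconnected boundary (§2 for the boundary tubes). [folklore] -/
theorem isPreconnected_boundary_off_cores
    (hdisj : Pairwise fun i j => Disjoint (range (h i).toFun) (range (h j).toFun))
    (hB : IsPreconnected ((𝓡∂ 4).boundary B)) :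
    IsPreconnected {p : ↥((𝓡∂ 4).boundary B) | (p : B) ∈ coresComplement h} := by
  haveI : PreconnectedSpace ↥((𝓡∂ 4).boundary B) := Subtype.preconnectedSpace hB
  rw [boundary_off_cores_eq h]
  exact isPreconnected_compl_iUnion_core (fun j => (h j).boundaryTube) fun i j hij =>
    disjoint_boundaryTube_target (hdisj hij)

/-- `∂B ∖ ⋃ Kᵢ` is nonempty as soon as `∂B` is (the complement of the cores is dense). [folklore] -/
theorem nonempty_boundary_off_cores
    (hdisj : Pairwise fun i j => Disjoint (range (h i).toFun) (range (h j).toFun))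
    (hB : ((𝓡∂ 4).boundary B).Nonempty) :
    {p : ↥((𝓡∂ 4).boundary B) | (p : B) ∈ coresComplement h}.Nonempty := by
  haveI : Nonempty ↥((𝓡∂ 4).boundary B) := hB.to_subtype
  rw [boundary_off_cores_eq h]
  exact (dense_compl_iUnion_core (fun j => (h j).boundaryTube) fun i j hij =>
    disjoint_boundaryTube_target (hdisj hij)).nonempty

end Base

/-! ## §4 The boundary of the Lefschetz base is connected -/

/-- **`∂ Base g` is connected**: `H₂(Base g; ℤ) = H₃(Base g; ℤ) = 0` (Milnor cover) give
`H³(Base g; ℤ) = 0` (universal coefficients) and `H₁(Base g, ∂; ℤ) = 0` (integral Lefschetz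
duality), so `H₀(∂ Base g; ℤ) → H₀(Base g; ℤ)` is injective by the pair sequence; a clopen subset
`C` of `∂ Base g` with points `x ∈ C`, `y ∉ C` would have `[x] ≠ [y]` (the counting functional of
`C` separates them) while `[x] = [y]` in the path-connected base.  (On paper
`∂ Base g = #^{2g} S¹ × S²`, Gompf–Stipsicz 1999, §8.2.) [cite: GompfStipsicz1999, §8.2] -/
theorem isConnected_boundary_base (g : ℕ) : IsConnected ((𝓡∂ 4).boundary (Base g)) := by
  set A := (𝓡∂ 4).boundary (Base g) with hA
  have h2 : IsZero (singularHomology ℤ ℤ (Base g) 2) := isZero_singularHomology_base_of_two_le ℤ ℤ g le_rfl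
  have h3 : IsZero (singularHomology ℤ ℤ (Base g) 3) :=
    isZero_singularHomology_base_of_two_le ℤ ℤ g (by norm_num)
  haveI : Subsingleton (singularHomology ℤ ℤ (Base g) 2) := ModuleCat.subsingleton_of_isZero h2
  haveI : Module.Free ℤ (singularHomology ℤ ℤ (Base g) 2) := Module.Free.of_subsingleton ℤ _
  have hH3 : Subsingleton (singularCohomology ℤ ℤ (Base g) 3) := subsingleton_cohomology_of_isZero 2 h3
  haveI : Nonempty (bBase g).carrier := nonempty_bBase_carrier g
  have hrel1 : IsZero (relativeSingularHomology ℤ ℤ (Base g) A 1) :=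
    isZero_relHomology_int_of_subsingleton_cohomology (bBase g) (isOrientable_base g)
      (p := 3) (q := 1) rfl hH3
  have hmono : Mono (singularHomology.map ℤ ℤ (⟨Subtype.val, continuous_subtype_val⟩ : C(↥A, Base g)) 0) :=
    (relativeSingularHomology.exact_δ_map ℤ ℤ A 0).mono_g (hrel1.eq_of_src _ _)
  have hinj := (ModuleCat.mono_iff_injective _).1 hmono
  have hne : Nonempty ↥A := ‹Nonempty (bBase g).carrier›
  rw [isConnected_iff_connectedSpace, connectedSpace_iff_clopen]
  refine ⟨hne, fun C hC => ?_⟩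
  by_contra hC'
  rw [not_or, ← ne_eq, ← nonempty_iff_ne_empty, ← ne_eq, ne_univ_iff_exists_notMem] at hC'
  obtain ⟨⟨x, hx⟩, ⟨y, hy⟩⟩ := hC'
  have hxy : pointClass ℤ (1 : ℤ) x = pointClass ℤ (1 : ℤ) y := by
    apply hinj
    show singularHomology.map ℤ ℤ _ 0 (pointClass ℤ 1 x) = singularHomology.map ℤ ℤ _ 0 (pointClass ℤ 1 y)
    rw [map_pointClass, map_pointClass]
    exact pointClass_eq_of_joined (1 : ℤ) (PathConnectedSpace.joined _ _)
  have h1 := clopenCountH_pointClass_of_mem hC (1 : ℤ) hx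
  rw [hxy, clopenCountH_pointClass_of_notMem hC (1 : ℤ) hy] at h1
  exact zero_ne_one h1

/-- **`∂ Base g` is a connected space** (the carrier of `bBase g` is the subtype `∂ Base g`).
[cite: GompfStipsicz1999, §8.2] -/
theorem connectedSpace_bBase_carrier (g : ℕ) : ConnectedSpace (bBase g).carrier :=
  isConnected_iff_connectedSpace.1 (isConnected_boundary_base g)

end BoundaryConnected

/-! ## §5 The registered sub-goal -/

/-- **Registered sub-goal `helper_isConnected_boundary_base`** of `stub_T3_dualPresentation`
(T3 clause (v), CONNECTED, input; wave 5, lead c5): the boundary `∂ Base g = {rho g = 1/4}` of the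
standard Lefschetz base is connected. [cite: GompfStipsicz1999, §8.2] -/
theorem helper_isConnected_boundary_base : ∀ g : ℕ, IsConnected ((𝓡∂ 4).boundary (Literature.Topology.FourManifolds.LefschetzBase.Base g)) :=
  BoundaryConnected.isConnected_boundary_base

end Summit.SmoothPoincare4.SmoothPoincare4.Theorems.AcyclicBisectionExists.ModpBraidOrbits
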